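import Literature.Computability.Cryptography.ShorOrderFindingQuantum
import Literature.Computability.Cryptography.ShorDiscreteLogQuantum
import Literature.Computability.Cryptography.HallgrenClassGroupCharacterCoordinates
import Literature.Computability.Cryptography.HallgrenClassGroupSubgroupOrder
import HarnessLib

/-!
# Hallgren 2005 / class numbers under GRH — step Q2d: the phase-estimation experiment for the
# order of a finite abelian group given by generators (layout, post-processing, correctness)

Topic `Literature/Computability/Cryptography`; proof companion of `HallgrenClassGroup.lean`
(named fact `Hallgren2005_classNumber_qsolvable_of_GRH`). Real definitions and theorems; no named
fact. The class-group twin of `ShorOrderFindingQuantum.lean` / `ShorDiscreteLogQuantum.lean`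
(one generator / two generators): here `K = clSlots ℓ` generators `g_i` of a finite abelian group
`G` (the subgroup of `Cl(−d)` generated by the sampled reduced forms, padded by the identity),
`T = clTrials ℓ` trials, and Kitaev's Hadamard tests of the controlled multiplications by
`2^l g_i` on the shared target register of each trial. By `kitaevCircuit_distributionChar`
(`HallgrenClassGroupCharacterSums.lean`) the control read-out is the uniform mixture over
`ψ ∈ Ĝ^T` of product weights with angles `arg ψ_t(2^l g_i)`; this file is the deterministic half
of the analysis (the probabilistic half is `HallgrenClassGroupQuantumSuccess.lean`):

* parameters `clSlots, clTrials, clLevels, clQ, clN, clBlockSize, clNumControls`, the layout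
  `clLayout` and blocks;
* the post-processing MODEL `clCnt → clLevelEst → clPhaseEst` (quadrant centres, halving
  refinement over `ℚ`, as in the twins), then per `(t, i)` Shor's nearest fraction `u/q` with
  `q < 4^ℓ` (`clDen` = `Shor1997.candidate`, `clNumr` = `roundMul`), the common denominator
  `clExp = lcm q`, the coordinate vectors `clRows ∈ ((ℤ/N)^K)^T` and **`clOrderEst`** =
  `SubgroupOrder.subgroupOrder` of them;
* the hidden law `clWeight`, the events `ClAccurate` (every block count within `B/16` of its
  mean);
* **`clOrderEst_eq_card`**: if the `g_i` generate `G`, `|G| < 4^ℓ`, the characters `ψ_t` generate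
  `Ĝ` and the read-out is accurate for `ψ`, then `clOrderEst = |G|` (phases `u/q` of the roots of
  unity `ψ_t(g_i)` are recovered exactly — `cdist ≤ (5/32)/16^ℓ`, Legendre/Shor uniqueness with
  `q < 4^ℓ ≤ √(16^ℓ)` — their lcm `N` kills `G`, the rows are the character coordinates
  `charCoord g N ψ_t`, and `card_closure_charCoord_eq` + `subgroupOrder_eq_card_closure`).

## References

* A. Yu. Kitaev, *Quantum measurements and the Abelian Stabilizer Problem*, arXiv:quant-ph/9511026
  (1995), §3 (Lemma 10, Thm. 1), §4 [Kitaev1995].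
* K. K. H. Cheung, M. Mosca, *Decomposing finite abelian groups*, Quantum Inf. Comput. 1 (2001),
  §3 [CheungMosca2001].
* A. M. Childs, W. van Dam, Rev. Mod. Phys. 82 (2010), §IV.D, §5.7 [ChildsVandam2010].
* S. Hallgren, *Fast quantum algorithms for computing the unit group and class group of a number
  field*, STOC 2005, §4 [Hallgren2005].
-/

noncomputable section

namespace Literature.Computability.Cryptography.Hallgren2005

open Complex Finset Real Kitaev1995 QuantumComplexity

/-! ### Parameters of the experiment (functions of the input length `ℓ`) -/

/-- Number of generator slots (`≤ ℓ` generators fit in an instance of length `ℓ`; unused slots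
carry the identity). [folklore] -/
def clSlots (ℓ : ℕ) : ℕ := ℓ

/-- Number of trials (independent uniformly random characters `ψ_t ∈ Ĝ`): `T = 4ℓ² + 4`, so that
`#Sub(Ĝ) · 2^{−T} ≤ 1/8` for `|G| < 4^ℓ` (`#Sub(Ĝ) ≤ (|G|+1)^{log₂ |G|} ≤ 2^{4ℓ²}`).
[cite: Kitaev1995, §4 (random elements generate unless in a common maximal subgroup)] -/
def clTrials (ℓ : ℕ) : ℕ := 4 * ℓ ^ 2 + 4

/-- Number of levels: powers `2^l`, `l < 4ℓ + 1`, precision `(5/32)/16^ℓ` for denominators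
`< 4^ℓ`. [cite: Kitaev1995, §3 Thm 1] -/
def clLevels (ℓ : ℕ) : ℕ := 4 * ℓ + 1

/-- Shor's precision modulus `q = 16^ℓ ≥ n²`, `n = 4^ℓ`. [cite: Shor1997, §5] -/
def clQ (ℓ : ℕ) : ℕ := 2 ^ (4 * ℓ)

/-- The denominator bound `n = 4^ℓ` (orders of the eigenvalues are `≤ |G| < 4^ℓ`). [folklore] -/
def clN (ℓ : ℕ) : ℕ := 2 ^ (2 * ℓ)

/-- Number of blocks `T · K · L · 2`. [folklore] -/
def clNumBlocks (ℓ : ℕ) : ℕ := clTrials ℓ * (clSlots ℓ * (clLevels ℓ * 2))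

/-- Repetitions per Hadamard test: `768 (#blocks + 1)`, so that Chebyshev and a union bound give
total failure `≤ 1/12`. [cite: Kitaev1995, §3 (before Lemma 9)] -/
def clBlockSize (ℓ : ℕ) : ℕ := 768 * (clNumBlocks ℓ + 1)

/-- Number of control wires. [folklore] -/
def clNumControls (ℓ : ℕ) : ℕ := clTrials ℓ * (clSlots ℓ * (clLevels ℓ * (2 * clBlockSize ℓ)))

/-- Test labels `(trial, slot, level, type, repetition)`. [folklore] -/
abbrev ClTestLabel (ℓ : ℕ) :=
  Fin (clTrials ℓ) × Fin (clSlots ℓ) × Fin (clLevels ℓ) × Bool × Fin (clBlockSize ℓ)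

/-- Block labels `(trial, slot, level, type)`. [folklore] -/
abbrev ClBlk (ℓ : ℕ) := Fin (clTrials ℓ) × Fin (clSlots ℓ) × Fin (clLevels ℓ) × Bool

/-- The layout of the control wires (mixed-radix digits). [folklore] -/
def clLayout (ℓ : ℕ) : Fin (clNumControls ℓ) ≃ ClTestLabel ℓ :=
  finProdFinEquiv.symm.trans <| Equiv.prodCongr (Equiv.refl _) <|
    finProdFinEquiv.symm.trans <| Equiv.prodCongr (Equiv.refl _) <|
      finProdFinEquiv.symm.trans <| Equiv.prodCongr (Equiv.refl _) <|
        finProdFinEquiv.symm.trans <| Equiv.prodCongr finTwoEquiv (Equiv.refl _)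

/-- The trial of control `j`. [folklore] -/
def clTrialOf (ℓ : ℕ) (j : Fin (clNumControls ℓ)) : Fin (clTrials ℓ) := (clLayout ℓ j).1

/-- The generator slot of control `j`. [folklore] -/
def clSlotOf (ℓ : ℕ) (j : Fin (clNumControls ℓ)) : Fin (clSlots ℓ) := (clLayout ℓ j).2.1

/-- The level of control `j`. [folklore] -/
def clLevelOf (ℓ : ℕ) (j : Fin (clNumControls ℓ)) : Fin (clLevels ℓ) := (clLayout ℓ j).2.2.1

/-- The type of control `j` (`true` = sine test). [folklore] -/
def clTypeOf (ℓ : ℕ) (j : Fin (clNumControls ℓ)) : Bool := (clLayout ℓ j).2.2.2.1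

/-- The block of control `j`. [folklore] -/
def clBlkOf (ℓ : ℕ) (j : Fin (clNumControls ℓ)) : ClBlk ℓ :=
  (clTrialOf ℓ j, clSlotOf ℓ j, clLevelOf ℓ j, clTypeOf ℓ j)

/-- The controls of a block. [folklore] -/
def clBlock (ℓ : ℕ) (β : ClBlk ℓ) : Finset (Fin (clNumControls ℓ)) :=
  univ.filter fun j => clBlkOf ℓ j = β

/-- Membership in a block. [folklore] -/
theorem mem_clBlock {ℓ : ℕ} {β : ClBlk ℓ} {j : Fin (clNumControls ℓ)} :
    j ∈ clBlock ℓ β ↔ clTrialOf ℓ j = β.1 ∧ clSlotOf ℓ j = β.2.1 ∧ clLevelOf ℓ j = β.2.2.1 ∧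
      clTypeOf ℓ j = β.2.2.2 := by
  obtain ⟨t, i, l, σ⟩ := β
  simp [clBlock, clBlkOf]

/-- A block is the image of the repetitions under the inverse layout. [folklore] -/
theorem clBlock_eq_image (ℓ : ℕ) (β : ClBlk ℓ) :
    clBlock ℓ β = univ.image fun r : Fin (clBlockSize ℓ) =>
      (clLayout ℓ).symm (β.1, β.2.1, β.2.2.1, β.2.2.2, r) := by
  ext j
  rw [mem_clBlock, mem_image]
  constructor
  · rintro ⟨h1, h2, h3, h4⟩
    refine ⟨(clLayout ℓ j).2.2.2.2, mem_univ _, ?_⟩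
    rw [Equiv.symm_apply_eq, ← h1, ← h2, ← h3, ← h4]
    rfl
  · rintro ⟨i, -, rfl⟩
    simp [clTrialOf, clSlotOf, clLevelOf, clTypeOf]

/-- Every block consists of `clBlockSize ℓ` controls. [folklore] -/
theorem card_clBlock (ℓ : ℕ) (β : ClBlk ℓ) : (clBlock ℓ β).card = clBlockSize ℓ := by
  rw [clBlock_eq_image, card_image_of_injective _ fun i i' h => by simpa using h]
  simp

/-- The block size is positive. [folklore] -/
theorem clBlockSize_pos (ℓ : ℕ) : 0 < clBlockSize ℓ := by
  unfold clBlockSize; positivity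

/-- `2^(clLevels ℓ - 1) = clQ ℓ`. [folklore] -/
theorem two_pow_clLevels_sub_one (ℓ : ℕ) : (2 : ℚ) ^ (clLevels ℓ - 1) = clQ ℓ := by
  simp [clLevels, clQ]

/-- `clN² = clQ`. [folklore] -/
theorem clN_sq (ℓ : ℕ) : clN ℓ ^ 2 = clQ ℓ := by
  rw [clN, clQ, ← pow_mul]; ring_nf

/-! ### The classical post-processing of a control read-out (the model) -/

/-- The number of `1`s read in block `β`. [cite: Kitaev1995, §3 (before Lemma 9)] -/
def clCnt {ℓ : ℕ} (β : ClBlk ℓ) (γ : Fin (clNumControls ℓ) → Bool) : ℕ :=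
  ((clBlock ℓ β).filter fun j => γ j = true).card

/-- The coarse localisation of `2^l φ_{t,i}` (quadrant centre). [cite: Kitaev1995, §3 Lemma 10] -/
def clLevelEst (ℓ : ℕ) (γ : Fin (clNumControls ℓ) → Bool) (t : Fin (clTrials ℓ))
    (i : Fin (clSlots ℓ)) (l : Fin (clLevels ℓ)) : ℚ :=
  quadrantCenter (decide (2 * clCnt (t, i, l, false) γ ≤ clBlockSize ℓ))
    (decide (2 * clCnt (t, i, l, true) γ ≤ clBlockSize ℓ))

/-- The refined estimate of the phase `φ_{t,i}` of the eigenvalue `ψ_t(g_i) = e^{2πi φ_{t,i}}`.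
[cite: Kitaev1995, §3 Lemma 10] -/
def clPhaseEst (ℓ : ℕ) (γ : Fin (clNumControls ℓ) → Bool) (t : Fin (clTrials ℓ))
    (i : Fin (clSlots ℓ)) : ℚ :=
  refined (fun l => if h : l < clLevels ℓ then clLevelEst ℓ γ t i ⟨l, h⟩ else 0) (clLevels ℓ)

/-- The recovered denominator `q_{t,i}` (Shor's nearest fraction with denominator `< 4^ℓ`).
[cite: Shor1997, §5 (continued fraction recovery); Kitaev1995, §3 Thm 1] -/
def clDen (ℓ : ℕ) (γ : Fin (clNumControls ℓ) → Bool) (t : Fin (clTrials ℓ)) (i : Fin (clSlots ℓ)) : ℕ :=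
  Shor1997.candidate (clN ℓ) (clQ ℓ) ((clPhaseEst ℓ γ t i : ℚ) : ℝ)

/-- The recovered numerator `u_{t,i} = round(φ̂ q) mod q`. [cite: Kitaev1995, §3 Thm 1] -/
def clNumr (ℓ : ℕ) (γ : Fin (clNumControls ℓ) → Bool) (t : Fin (clTrials ℓ)) (i : Fin (clSlots ℓ)) : ℕ :=
  roundMul (clDen ℓ γ t i) (clPhaseEst ℓ γ t i)

/-- The common denominator `N = lcm_{t,i} q_{t,i}` (an exponent of `G` on good accurate runs).
[cite: CheungMosca2001, §3] -/
def clExp (ℓ : ℕ) (γ : Fin (clNumControls ℓ) → Bool) : ℕ :=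
  univ.lcm fun p : Fin (clTrials ℓ) × Fin (clSlots ℓ) => clDen ℓ γ p.1 p.2

/-- The coordinate rows `(u_{t,i} N / q_{t,i})_i`, one per trial, as naturals. [cite: CheungMosca2001, §3] -/
def clRows (ℓ : ℕ) (γ : Fin (clNumControls ℓ) → Bool) : List (Fin (clSlots ℓ) → ℕ) :=
  (List.finRange (clTrials ℓ)).map fun t i => clNumr ℓ γ t i * (clExp ℓ γ / clDen ℓ γ t i)

/-- `subgroupOrder` on natural rows modulo `N` (`0` for the degenerate `N = 0`). [folklore] -/
def subgroupOrderNat (N k : ℕ) (rows : List (Fin k → ℕ)) : ℕ :=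
  if hN : N = 0 then 0 else
    haveI : NeZero N := ⟨hN⟩
    SubgroupOrder.subgroupOrder k (rows.map fun r i => ((r i : ℕ) : ZMod N))

/-- **The order read off a control read-out**: the order of the subgroup of `(ℤ/N)^K` generated by
the coordinate rows. [cite: CheungMosca2001, §3; Kitaev1995, §4] -/
def clOrderEst (ℓ : ℕ) (γ : Fin (clNumControls ℓ) → Bool) : ℕ :=
  subgroupOrderNat (clExp ℓ γ) (clSlots ℓ) (clRows ℓ γ)

/-! ### The hidden law of the read-out: product weights indexed by `ψ ∈ Ĝ^T` -/

section Law

variable {ℓ : ℕ} {G : Type*} [AddCommGroup G] (g : Fin (clSlots ℓ) → G)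

/-- The group element whose multiplication control `j` tests: `2^{level j} · g_{slot j}`. [cite: Kitaev1995, §3–§4] -/
def clW (j : Fin (clNumControls ℓ)) : G := 2 ^ (clLevelOf ℓ j : ℕ) • g (clSlotOf ℓ j)

/-- The weight of outcome `b` of control `j` under the characters `ψ`:
`(1 ± trig(arg ψ_{t(j)}(W_j)))/2`. [cite: Kitaev1995, §3 Remark 8] -/
def clWeight (ψ : Fin (clTrials ℓ) → AddChar G ℂ) (j : Fin (clNumControls ℓ)) (b : Bool) : ℝ :=
  testWeight b (clTypeOf ℓ j) (Complex.arg (ψ (clTrialOf ℓ j) (clW g j)))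

/-- The success parameter of block `(t, i, l, σ)`. [folklore] -/
def clBlockParam (ψ : Fin (clTrials ℓ) → AddChar G ℂ) (β : ClBlk ℓ) : ℝ :=
  testWeight true β.2.2.2 (Complex.arg (ψ β.1 (2 ^ (β.2.2.1 : ℕ) • g β.2.1)))

/-- On block `β` the weights of `1` are constant. [folklore] -/
theorem clWeight_true_of_mem_clBlock (ψ : Fin (clTrials ℓ) → AddChar G ℂ) {β : ClBlk ℓ}
    {j : Fin (clNumControls ℓ)} (hj : j ∈ clBlock ℓ β) :
    clWeight g ψ j true = clBlockParam g ψ β := by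
  obtain ⟨h1, h2, h3, h4⟩ := mem_clBlock.1 hj
  rw [clWeight, clBlockParam, clW, ← h1, ← h2, ← h3, ← h4]

/-- The mean number of `1`s in a block is `B · p_β`. [folklore] -/
theorem sum_clWeight_block (ψ : Fin (clTrials ℓ) → AddChar G ℂ) (β : ClBlk ℓ) :
    ∑ j ∈ clBlock ℓ β, clWeight g ψ j true = clBlockSize ℓ * clBlockParam g ψ β := by
  rw [sum_congr rfl fun j hj => clWeight_true_of_mem_clBlock g ψ hj, sum_const, card_clBlock,
    nsmul_eq_mul]

/-- `ClAccurate ψ γ`: in every block the count of `1`s is within `B/16` of its mean under `ψ`.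
[cite: Kitaev1995, §3 (before Lemma 9)] -/
def ClAccurate (ψ : Fin (clTrials ℓ) → AddChar G ℂ) (γ : Fin (clNumControls ℓ) → Bool) : Prop :=
  ∀ β : ClBlk ℓ, |(clCnt β γ : ℝ) - ∑ j ∈ clBlock ℓ β, clWeight g ψ j true| < clBlockSize ℓ / 16

/-- The weights are nonnegative. [folklore] -/
theorem clWeight_nonneg (ψ : Fin (clTrials ℓ) → AddChar G ℂ) (j : Fin (clNumControls ℓ)) (b : Bool) :
    0 ≤ clWeight g ψ j b :=
  testWeight_nonneg _ _ _

/-- The weights are normalised. [folklore] -/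
theorem clWeight_false_add_true (ψ : Fin (clTrials ℓ) → AddChar G ℂ) (j : Fin (clNumControls ℓ)) :
    clWeight g ψ j false + clWeight g ψ j true = 1 :=
  testWeight_false_add_true _ _

end Law

/-! ### Phases of roots of unity -/

/-- `cos (arg e^{iy}) = cos y` and `sin (arg e^{iy}) = sin y`. [folklore] -/
theorem cos_sin_arg_exp_mul_I (y : ℝ) :
    Real.cos (Complex.arg (Complex.exp (y * I))) = Real.cos y ∧
      Real.sin (Complex.arg (Complex.exp (y * I))) = Real.sin y := by
  have hne : Complex.exp (y * I) ≠ 0 := Complex.exp_ne_zero _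
  have hn : ‖Complex.exp (y * I)‖ = 1 := by rw [Complex.norm_exp_ofReal_mul_I]
  constructor
  · rw [Complex.cos_arg hne, hn, div_one, Complex.exp_ofReal_mul_I_re]
  · rw [Complex.sin_arg, hn, div_one, Complex.exp_ofReal_mul_I_im]

/-- **Every value of a character of a finite abelian group is `e^{2πi u/q}` in lowest terms** with
`0 < q ≤ |G|`, `u < q`. [folklore] -/
theorem exists_addChar_apply_eq_exp {G : Type*} [AddCommGroup G] [Fintype G] (ψ : AddChar G ℂ)
    (a : G) : ∃ q u : ℕ, 0 < q ∧ q ≤ Fintype.card G ∧ u < q ∧ u.Coprime q ∧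
      ψ a = Complex.exp (2 * π * I * ((u : ℂ) / q)) := by
  set n := Fintype.card G with hn
  have hn0 : n ≠ 0 := Fintype.card_ne_zero
  have hpow : ψ a ^ n = 1 := by
    rw [← AddChar.map_nsmul_eq_pow, hn, card_nsmul_eq_zero, AddChar.map_zero_eq_one]
  obtain ⟨c, hc, hcz⟩ := (Complex.isPrimitiveRoot_exp n hn0).eq_pow_of_pow_eq_one hpow
  set d := Nat.gcd c n with hd
  have hnpos : 0 < n := Nat.pos_of_ne_zero hn0
  have hd0 : 0 < d := Nat.gcd_pos_of_pos_right _ hnpos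
  have hdc : d ∣ c := Nat.gcd_dvd_left _ _
  have hdn : d ∣ n := Nat.gcd_dvd_right _ _
  have hq0 : 0 < n / d := Nat.div_pos (Nat.le_of_dvd hnpos hdn) hd0
  refine ⟨n / d, c / d, hq0, Nat.div_le_self _ _, Nat.div_lt_div_of_lt_of_dvd hdn hc,
    Nat.coprime_div_gcd_div_gcd hd0, ?_⟩
  have hmul : c * (n / d) = c / d * n := by
    obtain ⟨c', hc'⟩ := hdc
    obtain ⟨n', hn'⟩ := hdn
    rw [hc', hn', Nat.mul_div_cancel_left _ hd0, Nat.mul_div_cancel_left _ hd0]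
    ring
  have hq : ((n / d : ℕ) : ℂ) ≠ 0 := by exact_mod_cast hq0.ne'
  have hnC : (n : ℂ) ≠ 0 := by exact_mod_cast hn0
  rw [← hcz, zeta_pow_eq_exp]
  congr 2
  rw [div_eq_div_iff hnC hq]
  exact_mod_cast hmul

/-- `e^{2πi m} = 1` for a natural `m`. [folklore] -/
theorem exp_two_pi_mul_I_mul_natCast (m : ℕ) : Complex.exp (2 * π * I * m) = 1 := by
  rw [show (2 * π * I * m : ℂ) = m * (2 * π * I) by ring, Complex.exp_nat_mul, Complex.exp_two_pi_mul_I,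
    one_pow]

/-- `(e^{2πi u/q})^N = 1` when `q ∣ N`. [folklore] -/
theorem exp_pow_eq_one_of_dvd {q u N : ℕ} (hq : 0 < q) (hdvd : q ∣ N) :
    Complex.exp (2 * π * I * ((u : ℂ) / q)) ^ N = 1 := by
  obtain ⟨m, rfl⟩ := hdvd
  rw [← Complex.exp_nat_mul]
  have hqC : (q : ℂ) ≠ 0 := by exact_mod_cast hq.ne'
  have : ((q * m : ℕ) : ℂ) * (2 * π * I * ((u : ℂ) / q)) = 2 * π * I * ((u * m : ℕ) : ℂ) := by
    push_cast; field_simp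
  rw [this, exp_two_pi_mul_I_mul_natCast]

/-- `ζ_N^{u N/q} = e^{2πi u/q}` when `q ∣ N`. [folklore] -/
theorem zeta_pow_mul_div_eq {q u N : ℕ} (hq : 0 < q) (hN : 0 < N) (hdvd : q ∣ N) :
    Complex.exp (2 * π * I / N) ^ (u * (N / q)) = Complex.exp (2 * π * I * ((u : ℂ) / q)) := by
  rw [zeta_pow_eq_exp]
  congr 2
  obtain ⟨m, rfl⟩ := hdvd
  rw [Nat.mul_div_cancel_left _ hq]
  have hqC : (q : ℂ) ≠ 0 := by exact_mod_cast hq.ne'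
  have hmC : (m : ℂ) ≠ 0 := by
    have : 0 < m := Nat.pos_of_mul_pos_left hN
    exact_mod_cast this.ne'
  push_cast
  field_simp

/-! ### Correctness of the post-processing on accurate read-outs -/

section Correct

variable {ℓ : ℕ} {G : Type*} [AddCommGroup G] {g : Fin (clSlots ℓ) → G}
  {ψ : Fin (clTrials ℓ) → AddChar G ℂ} {γ : Fin (clNumControls ℓ) → Bool}

/-- The eigenvalue at level `l`: `ψ_t(2^l g_i) = e^{i · 2π u 2^l / q}`. [cite: Kitaev1995, §3 (the powers U^{2^l})] -/
theorem addChar_nsmul_eq_exp {t : Fin (clTrials ℓ)} {i : Fin (clSlots ℓ)} {q u : ℕ}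
    (hz : ψ t (g i) = Complex.exp (2 * π * I * ((u : ℂ) / q))) (l : ℕ) :
    ψ t (2 ^ l • g i) = Complex.exp (((2 * π * ((u : ℝ) * 2 ^ l / q) : ℝ) : ℂ) * I) := by
  rw [AddChar.map_nsmul_eq_pow, hz, ← Complex.exp_nat_mul]
  congr 1
  push_cast
  ring

/-- **Accurate read-outs localise every level**: `cdist (clLevelEst γ t i l) (2^l u/q) ≤ 5/32`.
[cite: Kitaev1995, §3 Lemma 10] -/
theorem cdist_clLevelEst_le (hacc : ClAccurate g ψ γ) {t : Fin (clTrials ℓ)} {i : Fin (clSlots ℓ)}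
    {q u : ℕ} (hz : ψ t (g i) = Complex.exp (2 * π * I * ((u : ℂ) / q))) (l : Fin (clLevels ℓ)) :
    cdist (clLevelEst ℓ γ t i l) (2 ^ (l : ℕ) * (u : ℚ) / q) ≤ 5 / 32 := by
  have hB := clBlockSize_pos ℓ
  have hcos := hacc (t, i, l, false)
  have hsin := hacc (t, i, l, true)
  rw [sum_clWeight_block] at hcos hsin
  simp only [clBlockParam, testWeight, if_true, if_false, Bool.false_eq_true] at hcos hsin
  rw [addChar_nsmul_eq_exp hz, (cos_sin_arg_exp_mul_I _).1] at hcos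
  rw [addChar_nsmul_eq_exp hz, (cos_sin_arg_exp_mul_I _).2] at hsin
  set θ : ℝ := 2 * π * ((u : ℝ) * 2 ^ (l : ℕ) / q) with hθ
  obtain ⟨hc1, hc2⟩ := trigEst_of_cnt (c₀ := Real.cos θ) hB hcos
  obtain ⟨hs1, hs2⟩ := trigEst_of_cnt (c₀ := Real.sin θ) hB hsin
  have hθ' : 2 * π * (((2 ^ (l : ℕ) * (u : ℚ) / q : ℚ)) : ℝ) = θ := by
    rw [hθ]; push_cast; ring
  unfold clLevelEst
  refine cdist_quadrantCenter_le_bool hc2 hs2 ?_ ?_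
  · rw [hθ']; exact hc1
  · rw [hθ']; exact hs1

/-- **Accurate read-outs estimate every phase to within `(5/32)/16^ℓ`.** [cite: Kitaev1995, §3 Lemma 10] -/
theorem cdist_clPhaseEst_le (hacc : ClAccurate g ψ γ) {t : Fin (clTrials ℓ)} {i : Fin (clSlots ℓ)}
    {q u : ℕ} (hz : ψ t (g i) = Complex.exp (2 * π * I * ((u : ℂ) / q))) :
    cdist (clPhaseEst ℓ γ t i) ((u : ℚ) / q) ≤ 5 / 32 / clQ ℓ := by
  rw [clPhaseEst, ← two_pow_clLevels_sub_one]
  refine cdist_refined_le (by unfold clLevels; omega) fun l hl => ?_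
  rw [dif_pos hl, show (2 : ℚ) ^ l * ((u : ℚ) / q) = 2 ^ l * (u : ℚ) / q by ring]
  exact cdist_clLevelEst_le hacc hz ⟨l, hl⟩

/-- **The denominator of an accurate pair `(t, i)` is recovered exactly** (`q < 4^ℓ`, `u/q` in lowest
terms; Shor's uniqueness with `clQ = clN²`). [cite: Kitaev1995, §3 Thm 1; Shor1997, §5] -/
theorem clDen_eq (hacc : ClAccurate g ψ γ) {t : Fin (clTrials ℓ)} {i : Fin (clSlots ℓ)} {q u : ℕ}
    (hz : ψ t (g i) = Complex.exp (2 * π * I * ((u : ℂ) / q))) (hq : 0 < q) (hqN : q < clN ℓ)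
    (hcop : u.Coprime q) : clDen ℓ γ t i = q := by
  obtain ⟨N, hN⟩ := exists_cdist_eq (clPhaseEst ℓ γ t i) ((u : ℚ) / q)
  have hclose := cdist_clPhaseEst_le hacc hz
  rw [hN] at hclose
  have hQ0 : (0 : ℝ) < clQ ℓ := by unfold clQ; positivity
  refine Shor1997.candidate_eq (d := (u : ℤ) + N * q) (le_of_eq (clN_sq ℓ)) hq hqN ?_ ?_
  · exact (Nat.isCoprime_iff_coprime.2 hcop).add_mul_right_left N
  · have hqr : (q : ℝ) ≠ 0 := by exact_mod_cast hq.ne'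
    have hcast : (((u : ℤ) + N * q : ℤ) : ℝ) / (q : ℝ) = (u : ℝ) / q + N := by
      push_cast
      rw [add_div, mul_div_assoc, div_self hqr, mul_one]
    rw [hcast]
    have hle : ((|clPhaseEst ℓ γ t i - (u : ℚ) / q - N| : ℚ) : ℝ) ≤ ((5 / 32 / clQ ℓ : ℚ) : ℝ) := by
      exact_mod_cast hclose
    push_cast at hle
    rw [show ((clPhaseEst ℓ γ t i : ℚ) : ℝ) - ((u : ℝ) / q + N) =
      (clPhaseEst ℓ γ t i : ℝ) - (u : ℝ) / q - N by ring]
    refine hle.trans ?_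
    rw [div_le_div_iff₀ hQ0 (by positivity)]
    nlinarith

/-- **The numerator of an accurate pair is recovered exactly.** [cite: Kitaev1995, §3 Thm 1] -/
theorem clNumr_eq (hacc : ClAccurate g ψ γ) {t : Fin (clTrials ℓ)} {i : Fin (clSlots ℓ)} {q u : ℕ}
    (hz : ψ t (g i) = Complex.exp (2 * π * I * ((u : ℂ) / q))) (hq : 0 < q) (hqN : q < clN ℓ)
    (huq : u < q) (hcop : u.Coprime q) : clNumr ℓ γ t i = u := by
  rw [clNumr, clDen_eq hacc hz hq hqN hcop]
  rw [roundMul_eq_mod hq, Nat.mod_eq_of_lt huq]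
  refine lt_of_le_of_lt (cdist_clPhaseEst_le hacc hz) ?_
  have hqQ : (q : ℚ) < clN ℓ := by exact_mod_cast hqN
  have hNQ : (clN ℓ : ℚ) ≤ clQ ℓ := by
    have : clN ℓ ≤ clQ ℓ := by
      rw [← clN_sq]; exact Nat.le_self_pow two_ne_zero _
    exact_mod_cast this
  have hq0 : (0 : ℚ) < q := by exact_mod_cast hq
  have hQ0 : (0 : ℚ) < clQ ℓ := by unfold clQ; positivity
  rw [div_lt_div_iff₀ hQ0 (by positivity)]
  nlinarith

/-- Rows of naturals modulo `N`, membership form of the range. [folklore] -/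
theorem setOf_mem_map_finRange {α : Type*} {T : ℕ} (f : Fin T → α) :
    {v | v ∈ (List.finRange T).map f} = Set.range f := by
  ext v
  simp [Set.mem_range, eq_comm]

/-- **Correctness of the post-processing** (Kitaev 1995, §4; Cheung–Mosca 2001, §3): if the `g_i`
generate `G`, `|G| < 4^ℓ`, the characters `ψ_t` generate `Ĝ` and the read-out is accurate for `ψ`,
then `clOrderEst ℓ γ = |G|`. [cite: Kitaev1995, §4; CheungMosca2001, §3] -/
theorem clOrderEst_eq_card [Fintype G] (hg : AddSubgroup.closure (Set.range g) = ⊤)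
    (hG : Fintype.card G < clN ℓ)
    (hψ : AddSubgroup.closure (Set.range ψ) = ⊤) (hacc : ClAccurate g ψ γ) :
    clOrderEst ℓ γ = Fintype.card G := by
  classical
  -- the phases `u/q` of the eigenvalues
  have hex := fun t i => exists_addChar_apply_eq_exp (ψ t) (g i)
  choose q u hq0 hqle hult hcop hz using hex
  have hqN : ∀ t i, q t i < clN ℓ := fun t i => lt_of_le_of_lt (hqle t i) hG
  have hden : ∀ t i, clDen ℓ γ t i = q t i := fun t i => clDen_eq hacc (hz t i) (hq0 t i) (hqN t i) (hcop t i)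
  have hnum : ∀ t i, clNumr ℓ γ t i = u t i := fun t i =>
    clNumr_eq hacc (hz t i) (hq0 t i) (hqN t i) (hult t i) (hcop t i)
  -- the common denominator `N`
  set N := clExp ℓ γ with hNdef
  have hNq : N = univ.lcm fun p : Fin (clTrials ℓ) × Fin (clSlots ℓ) => q p.1 p.2 := by
    rw [hNdef, clExp]; exact Finset.lcm_congr rfl fun p _ => hden p.1 p.2
  have hqdvd : ∀ t i, q t i ∣ N := fun t i => by
    rw [hNq]; exact Finset.dvd_lcm (mem_univ (t, i))
  have hN0 : N ≠ 0 := by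
    rw [hNq]
    simp only [ne_eq, Finset.lcm_eq_zero_iff, mem_univ, true_and, not_exists]
    exact fun p => (hq0 p.1 p.2).ne'
  have hNpos : 0 < N := Nat.pos_of_ne_zero hN0
  haveI : NeZero N := ⟨hN0⟩
  -- `N` kills `G`
  have hkillχ : ∀ (χ : AddChar G ℂ) (i : Fin (clSlots ℓ)), χ (N • g i) = 1 := by
    intro χ i
    have hχ : χ ∈ AddSubgroup.closure (Set.range ψ) := by rw [hψ]; exact AddSubgroup.mem_top χ
    induction hχ using AddSubgroup.closure_induction with
    | mem φ hφ =>
      obtain ⟨t, rfl⟩ := hφ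
      rw [AddChar.map_nsmul_eq_pow, hz t i]
      exact exp_pow_eq_one_of_dvd (hq0 t i) (hqdvd t i)
    | zero => rfl
    | add φ φ' _ _ h h' => rw [AddChar.add_apply, h, h', one_mul]
    | neg φ _ h => rw [AddChar.neg_apply, AddChar.map_neg_eq_inv, h, inv_one]
  have hkill : ∀ a : G, N • a = 0 := by
    intro a
    have ha : a ∈ AddSubgroup.closure (Set.range g) := by rw [hg]; exact AddSubgroup.mem_top a
    induction ha using AddSubgroup.closure_induction with
    | mem b hb =>
      obtain ⟨i, rfl⟩ := hb
      exact AddChar.forall_apply_eq_zero.1 fun χ => hkillχ χ i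
    | zero => exact nsmul_zero _
    | add b c _ _ hb hc => rw [nsmul_add, hb, hc, add_zero]
    | neg b _ hb => rw [smul_neg, hb, neg_zero]
  -- the rows are the character coordinates
  have hrow : ∀ t, (fun i => (((clNumr ℓ γ t i * (clExp ℓ γ / clDen ℓ γ t i) : ℕ) : ℕ) : ZMod N)) =
      charCoord g N (ψ t) := by
    intro t
    funext i
    rw [hnum, hden, ← hNdef, charCoord]
    exact natCast_eq_rootLog_of_pow_eq N
      ((zeta_pow_mul_div_eq (hq0 t i) hNpos (hqdvd t i)).trans (hz t i).symm)
  -- assemble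
  rw [clOrderEst, subgroupOrderNat, dif_neg hN0, SubgroupOrder.subgroupOrder_eq_card_closure, clRows,
    List.map_map]
  have hlist : ((List.finRange (clTrials ℓ)).map
      ((fun r i => ((r i : ℕ) : ZMod N)) ∘ fun t i => clNumr ℓ γ t i * (clExp ℓ γ / clDen ℓ γ t i))) =
      (List.finRange (clTrials ℓ)).map fun t => charCoord g N (ψ t) := by
    refine List.map_congr_left fun t _ => ?_
    exact hrow t
  rw [hlist, setOf_mem_map_finRange, card_closure_charCoord_eq g N hkill hg ψ hψ]

end Correct

end Literature.Computability.Cryptography.Hallgren2005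

end
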